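import Summits.QuantumFields.BalabanUV.T4Continuum.Spine.NE1p.DressedTowerWitnessPair

/-!
# T⁴ programme, spine estimate NE1′ (node O3b/H2) — TWO LIVE FAMILIES IN ONE MET COMPONENT WITH GENUINE ABSORPTION AT AN
# INTEGER BLOCKING FACTOR, part 2 of 3: the schedule-facing binders of the canonical terminal face on the two-family datum
# (formalisation crew `b2b-balaban-t4-ne1p-formalise-*`, leaf seat 04, generation 3; witness row W13 of `t4/formal/NE1p/LEAVES.md`,
# INTENT HOME/CLAIMS.log l.11538, BOOKED typer R-T59 (v) l.11573; NOT a crew estimate row)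

Cell `pub-balaban`, sub-cell `t4`, BINDER-OWNERS row NE1′ (owner lineage t4-ne1p-p1).  ADDITIVE — imports part 1
`Spine/NE1p/DressedTowerWitnessPair` (this seat: `Wp`, `BP`∕`TP`∕`towerP`, `SP`∕`SgP`, `FnP`, `𝒬P`, `atomP`, `defP`∕`dfP`) ONLY; modifies
nothing.  Part 3 = `Spine/NE1p/DressedTowerWitnessPairEnd.lean` (anchoring, absorption, the face APPLIED).

WHAT.  §4 the schedule-facing binders on the datum, for BOTH families and EVERY live generation: `hslP` — births through the
scheduled birth window at scale `0` (old family, window `bondBall c_P`) AND at scale `1` (young family, window `bondBall (c_P ψ)`);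
`hDμP`∕`hz₁P`; the fresh pairs `relGauge_pairsP` (serving `hpairx` for every `(f, j) ∈ SgP K k b` — the CROSS-FAMILY index set);
the (I4′) links `hδfP`∕`hδfwkP`∕`hdefwkP`∕`hrateP` and the source tie `hcmP` (equality `⅛ = ⅛`); and THE BOOKING CONVENTION that
replaces F-8 on the terminal faces: admissible pairs exist (`hneP`) and `hsupP : lin ≤ sSup (realised increments)` with the
increment set BOUNDED ABOVE (`incr_le`) and ATTAINED (`incr_mem`) — `Real.sSup` is a genuine supremum here, no junk value (the caveat
of LF-4).  §5 non-degeneracy records: positive sizes, TWO live generations in the shared component from scale `1` on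
(`card_SgP_two`), the coupling live and jumping (`xP_pos`).

WHAT IT IS NOT.  Not an estimate; [folklore] toy kernel mathematics ([decided toy]); 0 sorry, 0 citations, no `def … : Prop`; nothing
of Bałaban's densities or windows.  HONEST FRAMING.  Rung (B)+1 bookkeeping on ONE finite four-torus — NOT infinite volume, NOT a
mass gap, NOT OS on ℝ⁴, NOT Clay, NOT summit progress.  NE1′ is NOT PRINTED and NOT PROVED; spine PROVED 0∕9.  HONEST DEPENDENCY:
continuum YM on T⁴ ⇐ BetaPertH ∧ nine spine estimates (0/9 proved); BetaPertH ⇐ (D1) ∧ (D4) ∧ CAP+tail; G-an2-4 gates asym, D1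
and NE2/3/4.
-/

noncomputable section

namespace Summit.QuantumFields.BalabanUV.T4Continuum.NE1p.DressedTowerWitnessPair

open MeasureTheory Set Metric Filter Finset
open scoped BigOperators
open Literature.MathematicalPhysics.QuantumFieldTheory.Balaban1983to89
open Literature.MathematicalPhysics.QuantumFieldTheory.Balaban1983to89.T4TermFormat
open Literature.MathematicalPhysics.QuantumFieldTheory.Balaban1983to89.T4TermFormat.Booking
open Literature.MathematicalPhysics.QuantumFieldTheory.Balaban1983to89.T4GatedBooking
open Literature.MathematicalPhysics.QuantumFieldTheory.Balaban1983to89.T4TrajectoryComparison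
open T4TrajectoryModulus (bondBall bondBall_add_mem bondBall_latMove_add_mem bondBall_diam)
open T4BlockTransport (Fld NDir latMove latN Site norm_dir_le)
open T4BirthChartTransport (GaugeInvariant BirthSlice RelGauge)
open T4TrajectoryDensity
open Summit.QuantumFields.BalabanUV.T4Continuum.T4TrajectoryDensityDressed
open Summit.QuantumFields.BalabanUV.T4Continuum.T4TrajectoryDensityWitness
open Summit.QuantumFields.BalabanUV.T4Continuum.NE1p.DressedRoot
open Summit.QuantumFields.BalabanUV.T4Continuum.NE1p.DressedUniformConstants
open Summit.QuantumFields.BalabanUV.T4Continuum.NE1p.DressedWindowScheduleWin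
open Summit.QuantumFields.BalabanUV.T4Continuum.NE1p.DressedWindowScheduleModWin
open Summit.QuantumFields.BalabanUV.T4Continuum.NE1p.DressedTowerWitness
open Summit.QuantumFields.BalabanUV.T4Continuum.NE1p.DressedAbsorptionWitness (bs bs_le bs_false bs_true)

/-! ## §4 The schedule-facing binders on the datum [folklore] -/

/-- `hsl` (w1) FOR BOTH BIRTH SCALES: the birth slice of family `f` on ITS birth window `bondBall (c_P ψ^{j_f})` (scale `0` for the
old family, scale `1` for the young one) with bound `gP K f`; absent generations `0`. [folklore] -/
theorem hslP (K : ℕ) (f : (BP K).Birth) (k' : ℕ) :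
    BirthSlice (FnP K f k' k') latMove latN (bondBall 4 (Wp.ρw k') : Set (Fld 4 ℂ)) 1 1 ((TP K).gen f k') := by
  intro U hU p hp hp1
  by_cases hk : k' = bs K f
  · subst hk
    have hUc : ‖evB f U‖ ≤ cP * (((128 : ℝ) ^ 2)⁻¹) ^ bs K f := by rw [← Wp_ρw]; exact hU 0 (crd f)
    refine ⟨ball 0 (3 / latN p), ?_, fun t ht => ?_, discs_subset_ball hp hp1 (by norm_num)⟩
    · simp only [FnP, ↓reduceIte, evB_latMove]; fun_prop
    · show ‖FnP K f (bs K f) (bs K f) (latMove U p t)‖ ≤ (if bs K f = bs K f then gP K f else 0)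
      simp only [FnP, ↓reduceIte, evB_latMove, sub_self, Complex.ofReal_zero, add_zero]
      rw [norm_mul, Complex.norm_real, Real.norm_eq_abs, abs_of_pos (amp_pos K f), ← amp_mul_birthBound K f]
      have h3 : ‖t * evB f p.1.1‖ ≤ 3 := by
        rw [mem_ball, dist_zero_right] at ht
        rw [norm_mul]
        calc ‖t‖ * ‖evB f p.1.1‖ ≤ 3 / latN p * latN p :=
              mul_le_mul ht.le (norm_evB_dir_le f p) (norm_nonneg _) (by have := hp.le; positivity)
          _ = 3 := div_mul_cancel₀ _ hp.ne'
      exact mul_le_mul_of_nonneg_left ((norm_add_le _ _).trans (by linarith)) (amp_pos K f).le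
  · refine ⟨univ, ?_, fun t _ => ?_, fun _ _ => subset_univ _⟩
    · simp only [FnP, if_neg hk]; fun_prop
    · show ‖FnP K f k' k' (latMove U p t)‖ ≤ (if k' = bs K f then gP K f else 0)
      simp [FnP, hk]

/-- `hDμ`: both atoms of the step-`k` law lie in `bondBall (σ k) = bondBall (ψ^{k+1}∕4)`. [folklore] -/
theorem hDμP (k : ℕ) : ∀ᵐ z ∂flAt (atomP (k + 1)), z ∈ (bondBall 4 (Wp.σ k) : Set (Fld 4 ℂ)) := by
  refine ae_flAt.mpr ⟨fun x ν => ?_, fun x ν => ?_⟩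
  · rw [Wp_σ, Pi.zero_apply, Pi.zero_apply, norm_zero]; have := psiP_pos; positivity
  · rw [Wp_σ, pow_succ]
    simp only [atomP, Complex.norm_real, Real.norm_eq_abs]
    rw [abs_of_nonneg (by have := psiP_pos; positivity)]
    exact le_of_eq (by ring)

/-- `hz₁`: the reference fluctuation `0` lies in every fluctuation domain. [folklore] -/
theorem hz₁P (k : ℕ) : (0 : Fld 4 ℂ) ∈ (bondBall 4 (Wp.σ k) : Set (Fld 4 ℂ)) := fun x ν => by
  rw [Wp_σ, Pi.zero_apply, Pi.zero_apply, norm_zero]; have := psiP_pos; positivity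

/-- The direction realising the fresh pair at the second atom: the field `z_k` itself, declared bound `ψ^{k+1}∕4`. [folklore] -/
def dirAtomP (k : ℕ) : NDir 4 ℂ := fldDir (atomP (k + 1)) (dfP k) fun x ν => by
  simp only [atomP, Complex.norm_real, Real.norm_eq_abs, dfP]
  rw [abs_of_nonneg (by have := psiP_pos; positivity)]

/-- The direction realising the trivial pair at the reference atom: the zero field, declared bound `ψ^{k+1}∕4 > 0`. [folklore] -/
def dirNullP (k : ℕ) : NDir 4 ℂ := fldDir 0 (dfP k) fun x ν => by simpa using (dfP_pos k).le

/-- **`hpairx` AT BOTH ATOMS, FOR EVERY LIVE GENERATION OF EITHER FAMILY** [folklore]: for μ-a.e. `z` and EVERY base `Y`, the pair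
`(Y + 0, Y + z)` is in relative `Eq`-gauge with defect `ψ^{k+1}∕4`. -/
theorem relGauge_pairsP (k : ℕ) :
    ∀ᵐ z ∂flAt (atomP (k + 1)), ∀ Y : Fld 4 ℂ,
      RelGauge (fun U U' : Fld 4 ℂ => U = U') latMove latN (Y + 0) (Y + z) (dfP k) := by
  refine ae_flAt.mpr ⟨fun Y => ⟨dirNullP k, dfP_pos k, le_rfl, ?_⟩, fun Y => ⟨dirAtomP k, dfP_pos k, le_rfl, ?_⟩⟩
  · show Y + 0 = latMove (Y + 0) (dirNullP k) 1
    rw [dirNullP, latMove_fldDir_one, add_zero, add_zero]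
  · show Y + atomP (k + 1) = latMove (Y + 0) (dirAtomP k) 1
    rw [dirAtomP, latMove_fldDir_one, add_zero]

/-- `hδf` (I4′) for every live generation `(f, j)`: `0 ≤ ψ^{k+1}∕4 ≤ ½·ψ^{k−j}`. [folklore] -/
theorem hδfP (k j : ℕ) : 0 ≤ dfP k ∧ dfP k ≤ 1 / 2 * (((128 : ℝ) ^ 2)⁻¹) ^ (k - j) := by
  refine ⟨(dfP_pos k).le, ?_⟩
  unfold dfP
  have h1 : (((128 : ℝ) ^ 2)⁻¹) ^ (k + 1) ≤ (((128 : ℝ) ^ 2)⁻¹) ^ (k - j) :=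
    pow_le_pow_of_le_one psiP_pos.le psiP_le_one (by omega)
  have h0 : 0 ≤ (((128 : ℝ) ^ 2)⁻¹) ^ (k - j) := pow_nonneg psiP_pos.le _
  nlinarith

/-- `hδfwk`: the fresh defect is below the slice window `wc k = ψ^{k+1}∕2`. [folklore] -/
theorem hδfwkP (k : ℕ) : dfP k ≤ Wp.wc k := by
  rw [Wp_wc]; unfold dfP; rw [pow_succ]
  have h0 : 0 ≤ (((128 : ℝ) ^ 2)⁻¹) ^ k * ((128 : ℝ) ^ 2)⁻¹ := by have := psiP_pos; positivity
  nlinarith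

/-- `hdefwk`: the transverse defect `ψ^{k+1}∕2` IS the step's chart window. [folklore] -/
theorem hdefwkP (k : ℕ) : defP (k + 1) ≤ Wp.wc k := by
  rw [Wp_wc]; unfold defP; rw [pow_succ]; exact le_of_eq (by ring)

/-- `hrate` (I4′): the defect decays at the transport rate from any generation scale. [folklore] -/
theorem hrateP (k' k : ℕ) : defP (k + 1) ≤ 1 / 2 * (((128 : ℝ) ^ 2)⁻¹) ^ (k - k') := by
  unfold defP
  exact mul_le_mul_of_nonneg_left (pow_le_pow_of_le_one psiP_pos.le psiP_le_one (by omega)) (by norm_num)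

/-- `hcm`: the cutoff-free source condition `‖c‖ ≤ m` — with EQUALITY `⅛ = ⅛`. [folklore] -/
theorem hcmP : ‖(((1 / 8 : ℝ)) : ℂ)‖ ≤ 1 / 8 := by
  rw [Complex.norm_real, Real.norm_eq_abs, abs_of_pos (by norm_num : (0 : ℝ) < 1 / 8)]

/-! ### The booking convention `hne`∕`hsup`: admissible pairs exist; the increment set is bounded and attained [folklore] -/

/-- The gauge direction attaining family `f`'s booked size at step `k`: `δ_{k+1}·e_f`, declared bound `δ_{k+1}`. [folklore] -/
def dirB (f : Bool) (k : ℕ) : NDir 4 ℂ := fldDir (((defP k : ℝ) : ℂ) • eB f) (defP k) fun x ν => by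
  rw [Pi.smul_apply, Pi.smul_apply, norm_smul, Complex.norm_real, Real.norm_eq_abs, abs_of_pos (defP_pos k)]
  calc defP k * ‖eB f x ν‖ ≤ defP k * 1 := mul_le_mul_of_nonneg_left (norm_eB_le f x ν) (defP_pos k).le
    _ = defP k := mul_one _

/-- [folklore] Moving `0` by `1` along `dirB f k` puts `δ_k` on family `f`'s bond. -/
theorem evB_move_dirB (f : Bool) (k : ℕ) : evB f (latMove 0 (dirB f k) 1) = ((defP k : ℝ) : ℂ) := by
  rw [evB_latMove]
  show evB f 0 + 1 * evB f (((defP k : ℝ) : ℂ) • eB f) = _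
  rw [evB_smul, evB_eB, evB_zero]; ring

/-- A REALISED INCREMENT IS BOUNDED BY THE BOOKED SIZE [folklore]: for a pair in relative `Eq`-gauge of defect `δ`, the carried
functional of family `f` changes by at most `amp·δ` (birth generation) resp. `0`. -/
theorem incr_le (K : ℕ) (f : Bool) (k' k : ℕ) {U₀ U₁ : Fld 4 ℂ} {δ : ℝ}
    (h : RelGauge (fun U U' : Fld 4 ℂ => U = U') latMove latN U₀ U₁ δ) :
    ‖FnP K f k' k U₁ - FnP K f k' k U₀‖ ≤ (if k' = bs K f then amp K f * δ else 0) := by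
  obtain ⟨d, hd0, hdδ, rfl⟩ := h
  by_cases hk : k' = bs K f
  · rw [if_pos hk]
    simp only [FnP, if_pos hk, evB_latMove, one_mul]
    rw [show (amp K f : ℂ) * (evB f U₀ + evB f d.1.1 + ((shiftP K k - shiftP K (bs K f) : ℝ) : ℂ)) -
        (amp K f : ℂ) * (evB f U₀ + ((shiftP K k - shiftP K (bs K f) : ℝ) : ℂ)) = (amp K f : ℂ) * evB f d.1.1 by ring,
      norm_mul, Complex.norm_real, Real.norm_eq_abs, abs_of_pos (amp_pos K f)]
    exact mul_le_mul_of_nonneg_left ((norm_evB_dir_le f d).trans hdδ) (amp_pos K f).le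
  · rw [if_neg hk]; simp [FnP, hk]

/-- THE BOOKED SIZE IS A REALISED INCREMENT [folklore]: base `0`, gauge image `δ_{k+1}·e_f` (the dressing cancels). -/
theorem incr_mem (K : ℕ) (f : Bool) (k' k : ℕ) :
    (TP K).lin f k' k ∈ {x : ℝ | ∃ U₀ ∈ (bondBall 4 (Wp.ρw k) : Set (Fld 4 ℂ)), ∃ U₁ : Fld 4 ℂ,
      RelGauge (fun U U' : Fld 4 ℂ => U = U') latMove latN U₀ U₁ (defP (k + 1)) ∧
        x = ‖FnP K f k' k U₁ - FnP K f k' k U₀‖} := by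
  refine ⟨0, zero_mem_windowP k, latMove 0 (dirB f (k + 1)) 1, ⟨dirB f (k + 1), defP_pos (k + 1), le_rfl, rfl⟩, ?_⟩
  show (if k' = bs K f then amp K f * defP (k + 1) else 0) = _
  by_cases hk : k' = bs K f
  · rw [if_pos hk]
    simp only [FnP, if_pos hk, evB_move_dirB, evB_zero, zero_add]
    rw [show (amp K f : ℂ) * (((defP (k + 1) : ℝ) : ℂ) + ((shiftP K k - shiftP K (bs K f) : ℝ) : ℂ)) -
        (amp K f : ℂ) * ((shiftP K k - shiftP K (bs K f) : ℝ) : ℂ) = ((amp K f * defP (k + 1) : ℝ) : ℂ) by push_cast; ring,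
      Complex.norm_real, Real.norm_eq_abs, abs_of_pos (mul_pos (amp_pos K f) (defP_pos (k + 1)))]
  · rw [if_neg hk]; simp [FnP, hk]

/-- `hne` — ADMISSIBLE PAIRS EXIST at every step: `(0, δ_{k+1}·e_f)`. [folklore] -/
theorem hneP (f : Bool) (k : ℕ) :
    ∃ U₀ ∈ (bondBall 4 (Wp.ρw k) : Set (Fld 4 ℂ)), ∃ U₁ : Fld 4 ℂ,
      RelGauge (fun U U' : Fld 4 ℂ => U = U') latMove latN U₀ U₁ (defP (k + 1)) :=
  ⟨0, zero_mem_windowP k, latMove 0 (dirB f (k + 1)) 1, ⟨dirB f (k + 1), defP_pos (k + 1), le_rfl, rfl⟩⟩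

/-- **`hsup` — THE BOOKING CONVENTION: booked size ≤ sup of the realised increments** [folklore]: the increment set is BOUNDED
ABOVE by `amp·δ_{k+1}` (`incr_le`) and CONTAINS the booked size (`incr_mem`), so `Real.sSup` is a genuine supremum here (no junk
value) and `lin ≤ sSup`. -/
theorem hsupP (K : ℕ) (f : Bool) (k' k : ℕ) :
    (TP K).lin f k' k ≤ sSup {x : ℝ | ∃ U₀ ∈ (bondBall 4 (Wp.ρw k) : Set (Fld 4 ℂ)), ∃ U₁ : Fld 4 ℂ,
      RelGauge (fun U U' : Fld 4 ℂ => U = U') latMove latN U₀ U₁ (defP (k + 1)) ∧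
        x = ‖FnP K f k' k U₁ - FnP K f k' k U₀‖} := by
  refine le_csSup ⟨if k' = bs K f then amp K f * defP (k + 1) else 0, ?_⟩ (incr_mem K f k' k)
  rintro x ⟨U₀, _, U₁, hrel, rfl⟩
  exact incr_le K f k' k hrel

/-! ## §5 Non-degeneracy records [decided toy] -/

/-- Every booked size is positive at every cutoff and scale. [folklore] -/
theorem towerP_size_pos (K k : ℕ) (b : (BP K).Birth) : 0 < (BP K).size b k := mul_pos (amp_pos K b) (defP_pos (k + 1))

/-- From scale `1` on (within the cutoff) BOTH families are live in the shared component: the cross-family index set has TWO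
elements. [folklore] -/
theorem card_SgP_two {K k : ℕ} (hk1 : 1 ≤ k) (hkK : k ≤ K) (b : Bool) : (SgP K k b).card = 2 := by
  unfold SgP
  rw [Finset.card_image_of_injective _ fun f f' h => (Prod.mk.inj h).1]
  have hS : SP K k b = Finset.univ := by
    ext f
    simp only [SP, Finset.mem_filter, Finset.mem_univ, true_and, iff_true]
    have hb1 : bs K f ≤ 1 := by unfold bs; split_ifs <;> omega
    exact ⟨hb1.trans hk1, hkK⟩
  rw [hS]; rfl

/-- The coupling is LIVE from scale `0` and JUMPS at the young birth: `x_k > 0` for `k ≤ K`. [folklore] -/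
theorem xP_pos {K k : ℕ} (hkK : k ≤ K) : 0 < xP K k := by
  unfold xP
  have hmem : false ∈ SP K k false := Finset.mem_filter.mpr ⟨Finset.mem_univ _, by rw [bs_false]; exact ⟨Nat.zero_le _, hkK⟩⟩
  have h : 0 < ∑ f ∈ SP K k false, amp K f :=
    Finset.sum_pos' (fun f _ => (amp_pos K f).le) ⟨false, hmem, amp_pos K false⟩
  have := dfP_pos k
  positivity

end Summit.QuantumFields.BalabanUV.T4Continuum.NE1p.DressedTowerWitnessPair

end
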